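import Summits.BirchSwinnertonDyer.BirchSwinnertonDyer.Theorems.UniversalToricDescentSigmaCongruenceAtThreeIffInvariantPair
import Summits.BirchSwinnertonDyer.BirchSwinnertonDyer.Theorems.UniversalToricDescentDefectTransportModThreePTOfLambdaLe
import Summits.BirchSwinnertonDyer.BirchSwinnertonDyer.Theorems.UniversalToricDescentDeepLayerRigidity
import HarnessLib

/-!
# NODE `one-deep-layer` on crux A = `SigmaCongruenceAtThree` (stmt-BirchSwinnertonDyer-27120, UTD rank 201)

Crux-ideate g3 (standing cover, D-0160/D-0171). Currency: VALUES of the Σ-depleted frames at ONE deep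
ring-class layer. Write `X := 𝓛·Π_E(3^c)`, `Y := 𝓛′·Π_{E′}(3^c)` (the two Σ-depleted `R₀⟦T⟧`-frames of A with the
CANONICAL exponents `e_v := 3^{c_v}`), `ζ` a primitive `3ⁿ`-th root of unity in `ℂ₃`, `x = ζ − 1`
(`‖x‖^{φ(3ⁿ)} = ‖3‖`). LEVER (elementary, PROVED here in §1): since `Φ_{3ⁿ}(1+T) ≡ T^{φ(3ⁿ)} (mod 3)`, the single
value `H(ζ − 1) mod 3R₀[ζ]` IS `H̄ mod T^{φ(3ⁿ)}`; quantitatively, for `H ∈ R₀⟦T⟧` with norm profile `m`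
(`μ = 0`, `λ = m`) and `m < φ(3ⁿ)`: `‖H(ζ − 1)‖ = ‖ζ − 1‖^m > ‖3‖` (`norm_value_eq_of_profile`), while
`λ ≥ φ(3ⁿ)` forces `‖H(ζ − 1)‖ ≤ ‖3‖` (`norm_value_le_inv_of_forall_lt`). Hence ONE layer `n` with
`2·3^{n−1} > λ(Y)` DECIDES A: `λ(X) = λ(Y) ⟺ ‖X(ζₙ − 1)‖ = ‖Y(ζₙ − 1)‖`, and the one-sided consumer form
`λ(X) ≤ λ(Y) ⟺ ‖Y(ζₙ − 1)‖ ≤ ‖X(ζₙ − 1)‖` (`profile_eq_of_norm_value_eq`, `profile_le_of_norm_value_le`).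

PIECES (tags per D-0171; evidence = the theorems of this file, all sorry-free):
* §1 `SingleLayer` laws — PROVED support (generic prime `p`), not items.
* C⁼ `DeepNormTransferAtThree` — «at every layer `n ≥ 1`, for every primitive `3ⁿ`-th root `ζ` and all values
  `vX = X(ζ−1)`, `vY = Y(ζ−1)`: `‖3‖ < ‖vY‖ → ‖vX‖ = ‖vY‖`» over A's binders VERBATIM. Tag: EQUIV (= A modulo the
  printed `μ`-input `hB` = Hsieh Thm. B BY NAME): `sigmaCongruenceAtThree_of_deepNormTransfer hB : C⁼ → A` and
  `deepNormTransfer_of_sigmaCongruenceAtThree hB : A → C⁼` (§3). An EQUIV node needs children — below.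
* C≤ `DeepNormDominanceAtThree` — same with conclusion `‖vY‖ ≤ ‖vX‖`. Tag: WEAKER-or-equal (`C⁼ → C≤` proved,
  converse not claimed) and SUFFICIENT FOR THE PARENT: `defectTransportModThreePT_of_deepNormDominance hB : C≤ →
  DefectTransportModThreePT` (stmt-23042 BY NAME, via p706556 `defectTransportModThreePT_of_thmB_of_lambdaLe`). UNDECIDED.
* C^ρ `DeepNormRatioAtThree` (§5) — GUARD-FREE: «∃ ρ N₀, at every layer `n ≥ N₀`: `‖vX‖ = ρ·‖vY‖`». Tag: EQUIV modulo
  `hB` (`sigmaCongruenceAtThree_of_deepNormRatio hB : C^ρ → A`, `deepNormRatio_of_sigmaCongruenceAtThree hB : A → C^ρ`,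
  `defectTransportModThreePT_of_deepNormRatio hB : C^ρ → parent`), by the PROVED HL3 decider
  `profile_eq_of_forall_layer_ratio` (scale forcing: two consecutive layers past `max λ` pin `ρ = 1` and `λ(X) = λ(Y)`;
  the wild period constant is READ, never assumed a unit). This is the form HL1 ∧ HL2 deliver directly. UNDECIDED.
CHILDREN of C⁼ / C≤ / C^ρ (informal — the typed interface for ring-class VALUES of a BDP frame does not exist in the tree;
card `Ideas/one-deep-layer.md` §What-it-needs):
* (HL1_E, ATTACKABLE = print-by-reading) p-adic WALDSPURGER for the WILD frame at finite-order anticyclotomic `χ` of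
  conductor `3ⁿ`: `X(ζ_χ − 1) = c_𝓛 · κₙ · ι′⁻¹(Q_χ(E^Σ))²` with `c_𝓛 ∈ R₀` INDEPENDENT of `χ`, `κₙ` universal
  (Gauss sum / `3ⁿ`, the SAME for `E` and `E′`: both new vectors have Kirillov function `𝟙_{ℤ₃^×}` at the split
  place), `Q_χ(E^Σ) = Σ_σ χ(σ) log_{ω_E} P_{3ⁿ}^σ` ⊗ Σ-depletion — Liu–Zhang–Zhang 2018 Thm. 1.1.1(2) (all finite-order
  `χ`, `p ∣ N` allowed); tree fact `LiuZhangZhang2018.thm151_thm153_modularCurve_heegnerVector_additive` types `χ = 𝟙` only.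
* (HL1_{E′}, ATTACKABLE = print) the same for the tame twin: BDP 2013 Thm. 5.13 / Castella–Hsieh 2018 Thm. 4.9
  (`3 ∤ N′`), Castella 2018 (`3 ‖ N′`).
* (HL2, UNDECIDED research leaf; INSTRUMENTABLE at `n = 1`) TOWER KRIZ–LI, Gauss-normalised: `ι′⁻¹Q_χ(E^Σ) ≡
  ± ι′⁻¹Q_χ(E′^Σ) (mod 3R₀[χ])` up to an `R₀^×`-constant independent of `χ` — Kriz–Li 2019 Thm. 3.9's PROOF
  (stabilisation `θ^{-1}f^♭`, `q`-expansion principle on the ordinary locus of `X₀(27M″)`, `p ∣ N` allowed, their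
  Rem. 3.10) read at CM test triples of conductor `3ⁿ` at MEASURE level (the raw value congruence is vacuous for
  `n ≥ 2`: `v(𝔤(χₙ)) = (n/2)φ(3ⁿ)·v(ζₙ−1) > v(3)`). Printed METHOD, statement beyond print at `27 ∣ N`.
* (HL3, ATTACKABLE = provable algebra) two-layer SCALE FORCING for the constants: if `‖vX‖/‖vY‖ = ‖c‖` is the same
  at two layers `n ≠ n′` beyond `λ` then `‖c‖ = 1` (cf. NodeLambdaScaleBlind `ScaleForcing`).
BARRIER tags: `TraceZeroHeegnerTowerAtAdditiveSplitP` — not met (no traces/norm-compatibility: ONE layer, each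
Heegner point used individually); `NoAdmissiblePrimesAtThree` — n/a (no level raising); `AnomalousHeegnerLogWall` —
the guard `‖3‖ < ‖vY‖` is exactly «layer deeper than `λ(Y)`», where the wall is invisible.

KEEP/KILL (g3) of the live ideas, in this currency: lambda-scale-blind KEEP (its C⁺ = C⁼ + HL3); sqrt-toric-functional
KEEP (registered line; HL2 at measure level IS its Kβ restricted to one layer); deep-conductor-stability KEEP-DEMOTED
(its T3 must be Gauss-normalised — raw deep congruences are vacuous — and `a = 1`, one character per layer suffice:
this node is its corrected form); heegner-log-anchor KEEP as layer `n = 0` of this node (anchor locus thin);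
rankin-selberg-linearity-transplant KEEP-CONDITIONAL (`3 ∤ h_K`). New dead ends: mod-9 wall (`tr ρ_E(τ₃) = −1 ≠ 2`),
dihedral unfolding (slope `f/2`, never nearly ordinary), parity (`λ ≡ λ′ mod 2` automatic, no leverage).

THEOREMS + two `def`s; NO `sorry`; no new axioms; banned options absent. References: Washington GTM 83 §7.1–7.2;
Greenberg–Vatsal 2000 (1.5); Kriz–Li 2019 §3; Liu–Zhang–Zhang 2018 Thm. 1.1.1; Bertolini–Darmon–Prasanna 2013 Thm. 5.13.
-/

noncomputable section

open scoped Classical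

set_option linter.dupNamespace false
set_option autoImplicit false

namespace Summit.BirchSwinnertonDyer.BirchSwinnertonDyer.Cruxes.SigmaCongruenceAtThree.OneDeepLayer

open NumberField IsDedekindDomain
open Literature.NumberTheory.EllipticCurves Literature.NumberTheory.EllipticCurves.GreenbergVatsal2000
  Summit.BirchSwinnertonDyer.Rank1Residual.X11b
  Summit.BirchSwinnertonDyer.BirchSwinnertonDyer.Theorems
  Summit.BirchSwinnertonDyer.BirchSwinnertonDyer.Theorems.UniversalToricDescentNormProfile
  Summit.BirchSwinnertonDyer.BirchSwinnertonDyer.Theorems.UniversalToricDescentAcEulerFactor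
  Summit.BirchSwinnertonDyer.BirchSwinnertonDyer.Theorems.UniversalToricDescentDeepLayerRigidity
  Summit.BirchSwinnertonDyer.BirchSwinnertonDyer.Theorems.UniversalToricDescentSigmaCongruenceInvariantPair
  Summit.BirchSwinnertonDyer.BirchSwinnertonDyer.Theorems.UniversalToricDescentDefectTransportModThreePTOfLambdaLe
  Summit.BirchSwinnertonDyer.BirchSwinnertonDyer.Theses.UniversalToricDescent

/-! ## §1 Single-layer value laws in `R₀⟦T⟧` (PROVED, generic prime `p`) -/

section SingleLayer

variable {p : ℕ} [hp : Fact p.Prime]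

/-- Values of `H ∈ R₀⟦T⟧` exist on the open unit disc of `ℂ_p`. [folklore] -/
theorem exists_hasValueAt (H : UnrSeries p) {x : ℂ_[p]} (hx : ‖x‖ < 1) : ∃ v : ℂ_[p], H.HasValueAt x v := by
  have hs : Summable (fun k : ℕ ↦ ((PowerSeries.coeff k H : unrIntegers p) : ℂ_[p]) * x ^ k) := by
    refine (summable_geometric_of_lt_one (norm_nonneg x) hx).of_norm_bounded (fun k ↦ ?_)
    rw [norm_mul, norm_pow]
    exact mul_le_of_le_one_left (pow_nonneg (norm_nonneg x) k) (Halves.norm_coe_unrIntegers_le_one p _)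
  exact ⟨_, hs.hasSum⟩

/-- **The law below `λ`.** If `H ∈ R₀⟦T⟧` has norm profile `m` (`μ(H) = 0`, `λ(H) = m`), `ζ ∈ ℂ_p` is a primitive
`pⁿ`-th root of unity (`n ≥ 1`) and `m < φ(pⁿ)`, then every value `v = H(ζ − 1)` has `‖v‖ = ‖ζ − 1‖^m`, and this is
`> p⁻¹ = ‖p‖`: the term `H_m(ζ−1)^m` strictly dominates (coefficients below `m` lie in `pR₀`). [cite: Washington1997, §7.1–7.2] -/
theorem norm_value_eq_of_profile {H : UnrSeries p} {m n : ℕ} (hn : 0 < n)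
    (hH : (∀ i < m, ‖((PowerSeries.coeff i H : unrIntegers p) : ℂ_[p])‖ < 1) ∧
      ‖((PowerSeries.coeff m H : unrIntegers p) : ℂ_[p])‖ = 1)
    (hmφ : m < Nat.totient (p ^ n)) {ζ : ℂ_[p]} (hζ : IsPrimitiveRoot ζ (p ^ n)) {v : ℂ_[p]}
    (hv : H.HasValueAt (ζ - 1) v) :
    ‖v‖ = ‖ζ - 1‖ ^ m ∧ (p : ℝ)⁻¹ < ‖ζ - 1‖ ^ m := by
  obtain ⟨hr0, hr1⟩ := norm_sub_one_pos_lt_one_of_isPrimitiveRoot_prime_pow hn hζ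
  have hrφ : ‖ζ - 1‖ ^ Nat.totient (p ^ n) = (p : ℝ)⁻¹ :=
    norm_sub_one_pow_totient_of_isPrimitiveRoot_prime_pow hn hζ
  have hp0 : (0 : ℝ) < (p : ℝ)⁻¹ := by rw [← hrφ]; exact pow_pos hr0 _
  have hrm : (p : ℝ)⁻¹ < ‖ζ - 1‖ ^ m := by rw [← hrφ]; exact pow_lt_pow_right_of_lt_one₀ hr0 hr1 hmφ
  have hlow : ∀ i < m, ‖((PowerSeries.coeff i H : unrIntegers p) : ℂ_[p])‖ ≤ (p : ℝ)⁻¹ := fun i hi ↦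
    R1.norm_le_inv_of_norm_lt_one (PowerSeries.coeff i H).2 (hH.1 i hi)
  have hC0 : (0 : ℝ) ≤ max (p : ℝ)⁻¹ (‖ζ - 1‖ ^ (m + 1)) := le_max_of_le_left hp0.le
  have hdom : ∀ i : ℕ, i ≠ m →
      ‖((PowerSeries.coeff i H : unrIntegers p) : ℂ_[p]) * (ζ - 1) ^ i‖ ≤ max (p : ℝ)⁻¹ (‖ζ - 1‖ ^ (m + 1)) := by
    intro i hi
    rw [norm_mul, norm_pow]
    rcases Nat.lt_or_gt_of_ne hi with him | him
    · refine le_max_of_le_left ?_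
      calc ‖((PowerSeries.coeff i H : unrIntegers p) : ℂ_[p])‖ * ‖ζ - 1‖ ^ i ≤ (p : ℝ)⁻¹ * 1 :=
            mul_le_mul (hlow i him) (pow_le_one₀ hr0.le hr1.le) (pow_nonneg hr0.le i) hp0.le
        _ = (p : ℝ)⁻¹ := mul_one _
    · refine le_max_of_le_right ?_
      calc ‖((PowerSeries.coeff i H : unrIntegers p) : ℂ_[p])‖ * ‖ζ - 1‖ ^ i ≤ 1 * ‖ζ - 1‖ ^ (m + 1) :=
            mul_le_mul (Halves.norm_coe_unrIntegers_le_one p _)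
              (pow_le_pow_of_le_one hr0.le hr1.le (Nat.succ_le_of_lt him)) (pow_nonneg hr0.le i) zero_le_one
        _ = ‖ζ - 1‖ ^ (m + 1) := one_mul _
  have hlt : max (p : ℝ)⁻¹ (‖ζ - 1‖ ^ (m + 1)) <
      ‖((PowerSeries.coeff m H : unrIntegers p) : ℂ_[p]) * (ζ - 1) ^ m‖ := by
    rw [norm_mul, norm_pow, hH.2, one_mul]
    exact max_lt hrm (pow_lt_pow_right_of_lt_one₀ hr0 hr1 (Nat.lt_succ_self m))
  have hnormv := norm_eq_of_hasValueAt_of_dominant hv m hC0 hdom hlt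
  rw [norm_mul, norm_pow, hH.2, one_mul] at hnormv
  exact ⟨hnormv, hrm⟩

/-- **The law at and beyond `λ`.** If all coefficients of `H ∈ R₀⟦T⟧` below `φ(pⁿ)` are non-units (`λ(H̄) ≥ φ(pⁿ)`,
or `μ(H) > 0`), then every value `v = H(ζ − 1)` at a primitive `pⁿ`-th root of unity `ζ` (`n ≥ 1`) has `‖v‖ ≤ p⁻¹ = ‖p‖`
(every term has norm `≤ p⁻¹`: `‖ζ − 1‖^{φ(pⁿ)} = p⁻¹`). [cite: Washington1997, §7.1–7.2] -/
theorem norm_value_le_inv_of_forall_lt {H : UnrSeries p} {n : ℕ} (hn : 0 < n)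
    (hH : ∀ i < Nat.totient (p ^ n), ‖((PowerSeries.coeff i H : unrIntegers p) : ℂ_[p])‖ < 1)
    {ζ : ℂ_[p]} (hζ : IsPrimitiveRoot ζ (p ^ n)) {v : ℂ_[p]} (hv : H.HasValueAt (ζ - 1) v) :
    ‖v‖ ≤ (p : ℝ)⁻¹ := by
  obtain ⟨hr0, hr1⟩ := norm_sub_one_pos_lt_one_of_isPrimitiveRoot_prime_pow hn hζ
  have hrφ : ‖ζ - 1‖ ^ Nat.totient (p ^ n) = (p : ℝ)⁻¹ :=
    norm_sub_one_pow_totient_of_isPrimitiveRoot_prime_pow hn hζ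
  have hp0 : (0 : ℝ) < (p : ℝ)⁻¹ := by rw [← hrφ]; exact pow_pos hr0 _
  have hbound : ∀ k : ℕ, ‖((PowerSeries.coeff k H : unrIntegers p) : ℂ_[p]) * (ζ - 1) ^ k‖ ≤ (p : ℝ)⁻¹ := by
    intro k
    rw [norm_mul, norm_pow]
    rcases lt_or_ge k (Nat.totient (p ^ n)) with hk | hk
    · calc ‖((PowerSeries.coeff k H : unrIntegers p) : ℂ_[p])‖ * ‖ζ - 1‖ ^ k ≤ (p : ℝ)⁻¹ * 1 :=
            mul_le_mul (R1.norm_le_inv_of_norm_lt_one (PowerSeries.coeff k H).2 (hH k hk))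
              (pow_le_one₀ hr0.le hr1.le) (pow_nonneg hr0.le k) hp0.le
        _ = (p : ℝ)⁻¹ := mul_one _
    · calc ‖((PowerSeries.coeff k H : unrIntegers p) : ℂ_[p])‖ * ‖ζ - 1‖ ^ k ≤
            1 * ‖ζ - 1‖ ^ Nat.totient (p ^ n) :=
            mul_le_mul (Halves.norm_coe_unrIntegers_le_one p _) (pow_le_pow_of_le_one hr0.le hr1.le hk)
              (pow_nonneg hr0.le k) zero_le_one
        _ = (p : ℝ)⁻¹ := by rw [one_mul, hrφ]
  have hvf : HasSum (fun k : ℕ ↦ ((PowerSeries.coeff k H : unrIntegers p) : ℂ_[p]) * (ζ - 1) ^ k) v := hv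
  rw [← hvf.tsum_eq]
  exact IsUltrametricDist.norm_tsum_le_of_forall_le_of_nonneg hp0.le hbound

/-- **One-sided decider.** `X, Y ∈ R₀⟦T⟧` with norm profiles `M, M′`, one layer `n ≥ 1` with `M′ < φ(pⁿ)`, `ζ` a primitive
`pⁿ`-th root of unity, values `vX = X(ζ−1)`, `vY = Y(ζ−1)`: `‖vY‖ ≤ ‖vX‖ ⟹ λ(X) = M ≤ M′ = λ(Y)`. [folklore] -/
theorem profile_le_of_norm_value_le {X Y : UnrSeries p} {M M' n : ℕ} (hn : 0 < n)
    (hX : (∀ i < M, ‖((PowerSeries.coeff i X : unrIntegers p) : ℂ_[p])‖ < 1) ∧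
      ‖((PowerSeries.coeff M X : unrIntegers p) : ℂ_[p])‖ = 1)
    (hY : (∀ i < M', ‖((PowerSeries.coeff i Y : unrIntegers p) : ℂ_[p])‖ < 1) ∧
      ‖((PowerSeries.coeff M' Y : unrIntegers p) : ℂ_[p])‖ = 1)
    (hM'φ : M' < Nat.totient (p ^ n)) {ζ : ℂ_[p]} (hζ : IsPrimitiveRoot ζ (p ^ n)) {vX vY : ℂ_[p]}
    (hvX : X.HasValueAt (ζ - 1) vX) (hvY : Y.HasValueAt (ζ - 1) vY) (hle : ‖vY‖ ≤ ‖vX‖) : M ≤ M' := by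
  obtain ⟨hr0, hr1⟩ := norm_sub_one_pos_lt_one_of_isPrimitiveRoot_prime_pow hn hζ
  obtain ⟨hY', hpM'⟩ := norm_value_eq_of_profile hn hY hM'φ hζ hvY
  by_contra hlt
  have hlt' : M' < M := not_le.mp hlt
  rcases lt_or_ge M (Nat.totient (p ^ n)) with hMφ | hMφ
  · obtain ⟨hX', -⟩ := norm_value_eq_of_profile hn hX hMφ hζ hvX
    have hpow : ‖ζ - 1‖ ^ M < ‖ζ - 1‖ ^ M' := pow_lt_pow_right_of_lt_one₀ hr0 hr1 hlt'
    rw [hX', hY'] at hle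
    exact absurd hle (not_le.mpr hpow)
  · have hX' : ‖vX‖ ≤ (p : ℝ)⁻¹ :=
      norm_value_le_inv_of_forall_lt hn (fun i hi ↦ hX.1 i (lt_of_lt_of_le hi hMφ)) hζ hvX
    rw [hY'] at hle
    exact absurd (hle.trans hX') (not_le.mpr hpM')

/-- **Two-sided decider.** Same data: `‖vX‖ = ‖vY‖ ⟹ λ(X) = λ(Y)`. [folklore] -/
theorem profile_eq_of_norm_value_eq {X Y : UnrSeries p} {M M' n : ℕ} (hn : 0 < n)
    (hX : (∀ i < M, ‖((PowerSeries.coeff i X : unrIntegers p) : ℂ_[p])‖ < 1) ∧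
      ‖((PowerSeries.coeff M X : unrIntegers p) : ℂ_[p])‖ = 1)
    (hY : (∀ i < M', ‖((PowerSeries.coeff i Y : unrIntegers p) : ℂ_[p])‖ < 1) ∧
      ‖((PowerSeries.coeff M' Y : unrIntegers p) : ℂ_[p])‖ = 1)
    (hM'φ : M' < Nat.totient (p ^ n)) {ζ : ℂ_[p]} (hζ : IsPrimitiveRoot ζ (p ^ n)) {vX vY : ℂ_[p]}
    (hvX : X.HasValueAt (ζ - 1) vX) (hvY : Y.HasValueAt (ζ - 1) vY) (heq : ‖vX‖ = ‖vY‖) : M = M' := by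
  have h1 : M ≤ M' := profile_le_of_norm_value_le hn hX hY hM'φ hζ hvX hvY heq.ge
  have h2 : M' ≤ M := profile_le_of_norm_value_le hn hY hX (lt_of_le_of_lt h1 hM'φ) hζ hvY hvX heq.le
  exact le_antisymm h1 h2

/-- **Converse law (certifies EQUIV).** If `X, Y` have the SAME norm profile `M`, then at every layer `n ≥ 1` and every
primitive `pⁿ`-th root `ζ`: `‖p‖ < ‖Y(ζ−1)‖ ⟹ ‖X(ζ−1)‖ = ‖Y(ζ−1)‖` (the guard forces `M < φ(pⁿ)`). [folklore] -/
theorem norm_value_eq_of_profile_eq {X Y : UnrSeries p} {M : ℕ}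
    (hX : (∀ i < M, ‖((PowerSeries.coeff i X : unrIntegers p) : ℂ_[p])‖ < 1) ∧
      ‖((PowerSeries.coeff M X : unrIntegers p) : ℂ_[p])‖ = 1)
    (hY : (∀ i < M, ‖((PowerSeries.coeff i Y : unrIntegers p) : ℂ_[p])‖ < 1) ∧
      ‖((PowerSeries.coeff M Y : unrIntegers p) : ℂ_[p])‖ = 1)
    {n : ℕ} (hn : 0 < n) {ζ : ℂ_[p]} (hζ : IsPrimitiveRoot ζ (p ^ n)) {vX vY : ℂ_[p]}
    (hvX : X.HasValueAt (ζ - 1) vX) (hvY : Y.HasValueAt (ζ - 1) vY) (hguard : (p : ℝ)⁻¹ < ‖vY‖) :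
    ‖vX‖ = ‖vY‖ := by
  have hMφ : M < Nat.totient (p ^ n) := by
    by_contra hge
    have hle : ‖vY‖ ≤ (p : ℝ)⁻¹ :=
      norm_value_le_inv_of_forall_lt hn (fun i hi ↦ hY.1 i (lt_of_lt_of_le hi (not_lt.mp hge))) hζ hvY
    exact absurd (hguard.trans_le hle) (lt_irrefl _)
  obtain ⟨hX', -⟩ := norm_value_eq_of_profile hn hX hMφ hζ hvX
  obtain ⟨hY', -⟩ := norm_value_eq_of_profile hn hY hMφ hζ hvY
  rw [hX', hY']

end SingleLayer

/-! ## §2 Choosing the layer at `p = 3` (PROVED) and the Σ-depleted profile -/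

/-- `‖3‖ = 3⁻¹` in `ℂ₃`. [folklore] -/
theorem norm_three : ‖(3 : ℂ_[3])‖ = ((3 : ℕ) : ℝ)⁻¹ := by
  have := Literature.NumberTheory.LFunctions.Dwork.norm_natCast_p_padicComplex (p := 3)
  exact_mod_cast this

/-- **One deep layer decides `λ(X) ≤ λ(Y)`.** If at EVERY layer `n ≥ 1`, every primitive `3ⁿ`-th root `ζ` and all values
the guard `‖3‖ < ‖Y(ζ−1)‖` implies `‖Y(ζ−1)‖ ≤ ‖X(ζ−1)‖`, then `λ(X) ≤ λ(Y)` — used at the single layer `n = λ(Y) + 1`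
(`φ(3ⁿ) = 2·3^{λ(Y)} > λ(Y)`), where the guard holds automatically. [folklore] -/
theorem profile_le_of_forall_layer {X Y : UnrSeries 3} {M M' : ℕ}
    (hX : (∀ i < M, ‖((PowerSeries.coeff i X : unrIntegers 3) : ℂ_[3])‖ < 1) ∧
      ‖((PowerSeries.coeff M X : unrIntegers 3) : ℂ_[3])‖ = 1)
    (hY : (∀ i < M', ‖((PowerSeries.coeff i Y : unrIntegers 3) : ℂ_[3])‖ < 1) ∧
      ‖((PowerSeries.coeff M' Y : unrIntegers 3) : ℂ_[3])‖ = 1)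
    (h : ∀ n : ℕ, 0 < n → ∀ ζ : ℂ_[3], IsPrimitiveRoot ζ (3 ^ n) → ∀ vX vY : ℂ_[3],
      X.HasValueAt (ζ - 1) vX → Y.HasValueAt (ζ - 1) vY → ‖(3 : ℂ_[3])‖ < ‖vY‖ → ‖vY‖ ≤ ‖vX‖) :
    M ≤ M' := by
  set n : ℕ := M' + 1 with hn
  have hn1 : 0 < n := by omega
  have hφ : Nat.totient (3 ^ n) = 2 * 3 ^ (n - 1) := by
    rw [Nat.totient_prime_pow Nat.prime_three hn1]; ring
  have h3pow : n - 1 < 3 ^ (n - 1) := Nat.lt_pow_self (by norm_num)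
  have hM'φ : M' < Nat.totient (3 ^ n) := by rw [hφ]; omega
  haveI : NeZero ((3 : ℕ) : ℂ_[3]) := ⟨by exact_mod_cast (show (3 : ℕ) ≠ 0 by norm_num)⟩
  obtain ⟨ζ, hζ⟩ := HasEnoughRootsOfUnity.prim (M := ℂ_[3]) (n := 3 ^ n)
  obtain ⟨-, hr1⟩ := norm_sub_one_pos_lt_one_of_isPrimitiveRoot_prime_pow hn1 hζ
  obtain ⟨vX, hvX⟩ := exists_hasValueAt X hr1
  obtain ⟨vY, hvY⟩ := exists_hasValueAt Y hr1
  obtain ⟨hY', hpM'⟩ := norm_value_eq_of_profile hn1 hY hM'φ hζ hvY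
  have hguard : ‖(3 : ℂ_[3])‖ < ‖vY‖ := by rw [norm_three, hY']; exact hpM'
  exact profile_le_of_norm_value_le hn1 hX hY hM'φ hζ hvX hvY (h n hn1 ζ hζ vX vY hvX hvY hguard)

/-- **One deep layer decides `λ(X) = λ(Y)`** (two-sided form of `profile_le_of_forall_layer`). [folklore] -/
theorem profile_eq_of_forall_layer {X Y : UnrSeries 3} {M M' : ℕ}
    (hX : (∀ i < M, ‖((PowerSeries.coeff i X : unrIntegers 3) : ℂ_[3])‖ < 1) ∧
      ‖((PowerSeries.coeff M X : unrIntegers 3) : ℂ_[3])‖ = 1)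
    (hY : (∀ i < M', ‖((PowerSeries.coeff i Y : unrIntegers 3) : ℂ_[3])‖ < 1) ∧
      ‖((PowerSeries.coeff M' Y : unrIntegers 3) : ℂ_[3])‖ = 1)
    (h : ∀ n : ℕ, 0 < n → ∀ ζ : ℂ_[3], IsPrimitiveRoot ζ (3 ^ n) → ∀ vX vY : ℂ_[3],
      X.HasValueAt (ζ - 1) vX → Y.HasValueAt (ζ - 1) vY → ‖(3 : ℂ_[3])‖ < ‖vY‖ → ‖vX‖ = ‖vY‖) :
    M = M' := by
  set n : ℕ := M' + 1 with hn
  have hn1 : 0 < n := by omega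
  have hφ : Nat.totient (3 ^ n) = 2 * 3 ^ (n - 1) := by
    rw [Nat.totient_prime_pow Nat.prime_three hn1]; ring
  have h3pow : n - 1 < 3 ^ (n - 1) := Nat.lt_pow_self (by norm_num)
  have hM'φ : M' < Nat.totient (3 ^ n) := by rw [hφ]; omega
  haveI : NeZero ((3 : ℕ) : ℂ_[3]) := ⟨by exact_mod_cast (show (3 : ℕ) ≠ 0 by norm_num)⟩
  obtain ⟨ζ, hζ⟩ := HasEnoughRootsOfUnity.prim (M := ℂ_[3]) (n := 3 ^ n)
  obtain ⟨-, hr1⟩ := norm_sub_one_pos_lt_one_of_isPrimitiveRoot_prime_pow hn1 hζ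
  obtain ⟨vX, hvX⟩ := exists_hasValueAt X hr1
  obtain ⟨vY, hvY⟩ := exists_hasValueAt Y hr1
  obtain ⟨hY', hpM'⟩ := norm_value_eq_of_profile hn1 hY hM'φ hζ hvY
  have hguard : ‖(3 : ℂ_[3])‖ < ‖vY‖ := by rw [norm_three, hY']; exact hpM'
  exact profile_eq_of_norm_value_eq hn1 hX hY hM'φ hζ hvX hvY (h n hn1 ζ hζ vX vY hvX hvY hguard)

/-- **Norm profile of a Σ-depletion** `X = L·∏_{v∈T}P_v(q_v⁻¹(1+T)^{3^{c_v}})` with the canonical exponents: if `L` has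
profile `m` then `X` has profile `m + Σ_{v∈T} 3^{c_v}·d_v(E)` (`d_v` = multiplicity of `q_v⁻¹` as a root of `P̃_v`).
[cite: GreenbergVatsal2000, §1 display (9)] [cite: LeiMullerXia2023, Lemma 3.5, Cor. 3.8] -/
theorem normProfile_sigma {K : Type} [Field K] [NumberField K] (E : WeierstrassCurve K)
    (T : Finset (HeightOneSpectrum (𝓞 K))) (hT : ∀ v ∈ T, ((3 : ℕ) : 𝓞 K) ∉ v.asIdeal)
    (c : HeightOneSpectrum (𝓞 K) → ℕ) {L : UnrSeries 3} {m : ℕ}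
    (hm : (∀ i < m, ‖((PowerSeries.coeff i L : unrIntegers 3) : ℂ_[3])‖ < 1) ∧
      ‖((PowerSeries.coeff m L : unrIntegers 3) : ℂ_[3])‖ = 1) :
    (∀ i < (m + ∑ v ∈ T, 3 ^ c v * (eulerFactorModP E 3 v).rootMultiplicity
          (((Nat.card (IsLocalRing.ResidueField (v.adicCompletionIntegers K)) : ℕ) : ZMod 3)⁻¹)),
        ‖((PowerSeries.coeff i (L * PowerSeries.map (Halves.toUnr 3) (∏ v ∈ T, (Polynomial.aeval
          (PowerSeries.C ((Nat.card (IsLocalRing.ResidueField (v.adicCompletionIntegers K)) : ℤ_[3]).inv) *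
            PowerSeries.binomialSeries ℤ_[3] ((3 : ℤ_[3]) ^ c v)) (E.localPolynomialAt v) : IwasawaAlgebra 3))) :
          unrIntegers 3) : ℂ_[3])‖ < 1) ∧
      ‖((PowerSeries.coeff (m + ∑ v ∈ T, 3 ^ c v * (eulerFactorModP E 3 v).rootMultiplicity
          (((Nat.card (IsLocalRing.ResidueField (v.adicCompletionIntegers K)) : ℕ) : ZMod 3)⁻¹))
          (L * PowerSeries.map (Halves.toUnr 3) (∏ v ∈ T, (Polynomial.aeval
          (PowerSeries.C ((Nat.card (IsLocalRing.ResidueField (v.adicCompletionIntegers K)) : ℤ_[3]).inv) *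
            PowerSeries.binomialSeries ℤ_[3] ((3 : ℤ_[3]) ^ c v)) (E.localPolynomialAt v) : IwasawaAlgebra 3))) :
          unrIntegers 3) : ℂ_[3])‖ = 1 := by
  haveI : Fact (Nat.Prime 3) := ⟨Nat.prime_three⟩
  have he : ∀ v ∈ T, (3 : ℤ_[3]) ^ c v ≠ 0 := fun v _ ↦ (pow_three_ne_zero_and_valuation (c v)).1
  obtain ⟨-, hord⟩ := order_map_toZMod_prod_aeval_localPolynomialAt E T hT (fun v ↦ (3 : ℤ_[3]) ^ c v) he
  have hP := normProfile_map_toUnr_of_order_eq _ hord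
  have key : ∑ v ∈ T, (eulerFactorModP E 3 v).rootMultiplicity
          (((Nat.card (IsLocalRing.ResidueField (v.adicCompletionIntegers K)) : ℕ) : ZMod 3)⁻¹) *
        3 ^ ((3 : ℤ_[3]) ^ c v).valuation =
      ∑ v ∈ T, 3 ^ c v * (eulerFactorModP E 3 v).rootMultiplicity
          (((Nat.card (IsLocalRing.ResidueField (v.adicCompletionIntegers K)) : ℕ) : ZMod 3)⁻¹) :=
    Finset.sum_congr rfl fun v _ ↦ by rw [(pow_three_ne_zero_and_valuation (c v)).2, mul_comm]
  rw [← key]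
  exact normProfile_mul hm hP

/-! ## §3 The pieces over A's binders VERBATIM -/

/-- Common SHAPE of the two pieces: A's binders (O6 wild curve `E` with `ρ̄₃` onto and `r_an = 1`, `3`-congruent
non-additive twin `E′`, strict Heegner `K`, anticyclotomic `κ`, generator `γ`, degree-one `𝔭 ∋ 3`, the other slot `𝔭′`,
branch `ι′`, frames `𝓛, 𝓛′` with `μ(𝓛′) = 0`, bad set `T`, exact indices `c_v`) followed by: for every layer `n ≥ 1`, every
primitive `3ⁿ`-th root of unity `ζ ∈ ℂ₃` and all values `vX = (𝓛·Π_E(3^c))(ζ−1)`, `vY = (𝓛′·Π_{E′}(3^c))(ζ−1)`: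
`‖3‖ < ‖vY‖ → rel ‖vX‖ ‖vY‖`. [folklore] -/
def DeepNormShapeAtThree (rel : ℝ → ℝ → Prop) : Prop :=
      ∀ (W : WeierstrassCurve ℚ) [W.IsElliptic] [W.IsGloballyMinimal] (W' : WeierstrassCurve ℚ) [W'.IsElliptic]
      [W'.IsGloballyMinimal] (N N' : ℕ) [NeZero N] [NeZero N'] (K : Type) [Field K] [NumberField K] (Dt :
      Literature.NumberTheory.EllipticCurves.ModularForms.ModularParametrizationData W N) (Dt' :
      Literature.NumberTheory.EllipticCurves.ModularForms.ModularParametrizationData W' N'),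
      Summit.BirchSwinnertonDyer.Rank1Residual.Additive.ClassO6 W 3 → W.HasSurjectiveModNGaloisRep 3 →
      W.analyticRank = 1 → W.conductorNorm ℤ = N → Summit.BirchSwinnertonDyer.Rank1Residual.O6.ModPCongruent W' W
      3 → ¬ Literature.NumberTheory.EllipticCurves.Rank1Residual.Addv W' 3 → W'.conductorNorm ℤ = N' →
      Literature.NumberTheory.EllipticCurves.IsImaginaryQuadratic K →
      Literature.NumberTheory.EllipticCurves.SatisfiesHeegnerHypothesis N K →
      Literature.NumberTheory.EllipticCurves.SatisfiesHeegnerHypothesis N' K → ∀ (κ :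
      Literature.NumberTheory.EllipticCurves.ZpExtension K 3), κ.IsAnticyclotomic → ∀ (γ :
      Field.absoluteGaloisGroup K) [Fact (κ.IsTopGenerator γ)] (𝔭 : IsDedekindDomain.HeightOneSpectrum
      (NumberField.RingOfIntegers K)), ((3 : ℕ) : NumberField.RingOfIntegers K) ∈ 𝔭.asIdeal →
      𝔭.asIdeal.ramificationIdx (NumberField.RingOfIntegers ℚ) = 1 → 𝔭.asIdeal.inertiaDeg
      (NumberField.RingOfIntegers ℚ) = 1 → ∀ (𝔭' : IsDedekindDomain.HeightOneSpectrum (NumberField.RingOfIntegers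
      K)), ((3 : ℕ) : NumberField.RingOfIntegers K) ∈ 𝔭'.asIdeal → 𝔭' ≠ 𝔭 → ∀ (ι' : PadicAlgCl 3 ≃+* ℂ),
      Summit.BirchSwinnertonDyer.BirchSwinnertonDyer.Theorems.SchneiderFree.BranchInducesPrime 3 ι' 𝔭 → ∀ (ΩK : ℂ)
      (Ωp : ℂ_[3]) (L : Literature.NumberTheory.EllipticCurves.UnrSeries 3), ΩK ≠ 0 → Ωp ≠ 0 →
      Literature.NumberTheory.EllipticCurves.IsBDPLFunction ι' 𝔭 κ γ Dt.f ΩK Ωp L → ∀ (ΩK' : ℂ) (Ωp' : ℂ_[3]) (L'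
      : Literature.NumberTheory.EllipticCurves.UnrSeries 3), ΩK' ≠ 0 → Ωp' ≠ 0 →
      Literature.NumberTheory.EllipticCurves.IsBDPLFunction ι' 𝔭 κ γ Dt'.f ΩK' Ωp' L' → (∃ i : ℕ,
      ‖((PowerSeries.coeff i L' : Literature.NumberTheory.EllipticCurves.unrIntegers 3) : ℂ_[3])‖ = 1) → ∀ (T :
      Finset (IsDedekindDomain.HeightOneSpectrum (NumberField.RingOfIntegers K))) (c :
      IsDedekindDomain.HeightOneSpectrum (NumberField.RingOfIntegers K) → ℕ), (↑T = {v :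
      IsDedekindDomain.HeightOneSpectrum (NumberField.RingOfIntegers K) | ((3 : ℕ) : NumberField.RingOfIntegers K)
      ∉ v.asIdeal ∧ (¬ (W.baseChange K).HasGoodReductionAt v ∨ ¬ (W'.baseChange K).HasGoodReductionAt v)}) → (∀ v
      ∈ T, (∃ d₀ : Literature.NumberTheory.EllipticCurves.GreenbergSelmer.decomp (K := K) v, (κ (d₀ :
      Field.absoluteGaloisGroup K)).toAdd = (3 : ℤ_[3]) ^ c v) ∧ (∀ d :
      Literature.NumberTheory.EllipticCurves.GreenbergSelmer.decomp (K := K) v, (3 : ℤ_[3]) ^ c v ∣ (κ (d :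
      Field.absoluteGaloisGroup K)).toAdd)) →
      ∀ n : ℕ, 0 < n → ∀ ζ : ℂ_[3], IsPrimitiveRoot ζ (3 ^ n) → ∀ vX vY : ℂ_[3],
        UnrSeries.HasValueAt (L * PowerSeries.map (Halves.toUnr 3) (∏ v ∈ T, (Polynomial.aeval
          (PowerSeries.C ((Nat.card (IsLocalRing.ResidueField (v.adicCompletionIntegers K)) : ℤ_[3]).inv) *
            PowerSeries.binomialSeries ℤ_[3] ((3 : ℤ_[3]) ^ c v)) ((W.baseChange K).localPolynomialAt v) :
            IwasawaAlgebra 3))) (ζ - 1) vX →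
        UnrSeries.HasValueAt (L' * PowerSeries.map (Halves.toUnr 3) (∏ v ∈ T, (Polynomial.aeval
          (PowerSeries.C ((Nat.card (IsLocalRing.ResidueField (v.adicCompletionIntegers K)) : ℤ_[3]).inv) *
            PowerSeries.binomialSeries ℤ_[3] ((3 : ℤ_[3]) ^ c v)) ((W'.baseChange K).localPolynomialAt v) :
            IwasawaAlgebra 3))) (ζ - 1) vY →
        ‖(3 : ℂ_[3])‖ < ‖vY‖ → rel ‖vX‖ ‖vY‖

/-- **C⁼ `DeepNormTransferAtThree` (tag EQUIV to A modulo `hB`; UNDECIDED).** «At every deep ring-class layer the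
Σ-depleted frames of the `3`-congruent pair have values of EQUAL NORM whenever the twin's value is not divisible by
`3`.» In Heegner currency (children HL1–HL3 of the module docstring): the Gauss-normalised `χ`-twisted Σ-depleted
Heegner-log sums of `E` and `E′` at ONE conductor `3ⁿ` with `2·3^{n−1} > λ(𝓛′^Σ)` have the same `3`-adic valuation.
[cite: GreenbergVatsal2000, Thm. (1.5)] [cite: KrizLi2019, Thm. 3.9, Rem. 3.10] [cite: LiuZhangZhang2018, Thm. 1.1.1] -/
def DeepNormTransferAtThree : Prop :=
  DeepNormShapeAtThree (fun a b ↦ a = b)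

/-- **C≤ `DeepNormDominanceAtThree` (tag WEAKER-or-equal than C⁼, sufficient for the PARENT ♭T≤; UNDECIDED).** «… the wild
value DOMINATES: `‖vY‖ ≤ ‖vX‖`», i.e. `v₃(Q_χ(E^Σ)) ≤ v₃(Q_χ(E′^Σ))` at one deep layer — the one-sided divisibility
`𝓛^Σ_E mod 𝔪 ∣ 𝓛′^Σ_{E′} mod 𝔪` that stmt-23042 actually consumes. [cite: GreenbergVatsal2000, Thm. (1.5)]
[cite: KrizLi2019, Thm. 3.9] -/
def DeepNormDominanceAtThree : Prop :=
  DeepNormShapeAtThree (fun a b ↦ b ≤ a)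

/-- `C⁼ → C≤`. [folklore] -/
theorem deepNormDominance_of_deepNormTransfer (h : DeepNormTransferAtThree) : DeepNormDominanceAtThree := by
  unfold DeepNormTransferAtThree DeepNormDominanceAtThree DeepNormShapeAtThree at *
  intro W _ _ W' _ _ N N' _ _ K _ _ Dt Dt' hO6 hsurj hrk hN hmod haddv hN' hK hH hH' κ hκ γ _ 𝔭 h𝔭 hram hdeg 𝔭'
    h𝔭' hne ι' hι ΩK Ωp L hΩK hΩp hL ΩK' Ωp' L' hΩK' hΩp' hL' hi' T c hT hc n hn ζ hζ vX vY hvX hvY hguard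
  exact (h W W' N N' K Dt Dt' hO6 hsurj hrk hN hmod haddv hN' hK hH hH' κ hκ γ 𝔭 h𝔭 hram hdeg 𝔭' h𝔭' hne ι' hι ΩK
    Ωp L hΩK hΩp hL ΩK' Ωp' L' hΩK' hΩp' hL' hi' T c hT hc n hn ζ hζ vX vY hvX hvY hguard).ge

/-! ## §4 Compositions BY NAME -/

/-- **C⁼ ⟹ A `SigmaCongruenceAtThree` BY NAME** (modulo print: `hB` = Hsieh Thm. B, `μ(𝓛) = 0` for the wild frame).
Proof: A ⟺ the λ-identity (`sigmaCongruenceAtThree_iff_lambdaIdentity_of_thmB`); the Σ-depletions have profiles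
`M = m + Σ3^{c}d(E)`, `M′ = m′ + Σ3^{c}d(E′)` (`normProfile_sigma`); one deep layer decides `M = M′`
(`profile_eq_of_forall_layer`). [cite: GreenbergVatsal2000, Thm. (1.5)] [cite: Hsieh2014, Thm. B] -/
theorem sigmaCongruenceAtThree_of_deepNormTransfer
    (hB : Literature.NumberTheory.EllipticCurves.Hsieh2014.thmB_exists_isHsiehLFunction_coeff_norm_eq_one_unrPeriod_anyLevel)
    (h : DeepNormTransferAtThree) : SigmaCongruenceAtThree := by
  haveI : Fact (Nat.Prime 3) := ⟨Nat.prime_three⟩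
  unfold DeepNormTransferAtThree DeepNormShapeAtThree at h
  refine (sigmaCongruenceAtThree_iff_lambdaIdentity_of_thmB hB).mpr ?_
  intro W _ _ W' _ _ N N' _ _ K _ _ Dt Dt' hO6 hsurj hrk hN hmod haddv hN' hK hH hH' κ hκ γ _ 𝔭 h𝔭 hram hdeg 𝔭'
    h𝔭' hne ι' hι ΩK Ωp L hΩK hΩp hL ΩK' Ωp' L' hΩK' hΩp' hL' hi' T c hT hc m m' hm hm'
  have hT3 := not_mem_of_coe_eq hT
  exact profile_eq_of_forall_layer (normProfile_sigma (W.baseChange K) T hT3 c hm)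
    (normProfile_sigma (W'.baseChange K) T hT3 c hm')
    (h W W' N N' K Dt Dt' hO6 hsurj hrk hN hmod haddv hN' hK hH hH' κ hκ γ 𝔭 h𝔭 hram hdeg 𝔭' h𝔭' hne ι' hι ΩK Ωp L
      hΩK hΩp hL ΩK' Ωp' L' hΩK' hΩp' hL' hi' T c hT hc)

/-- **C≤ ⟹ the PARENT ♭T≤ `DefectTransportModThreePT` (stmt-BirchSwinnertonDyer-23042) BY NAME** (modulo `hB`), via the
landed one-sided consumer `defectTransportModThreePT_of_thmB_of_lambdaLe` (p706556): one deep layer with wild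
dominance gives `λ(𝓛^Σ_E) ≤ λ(𝓛′^Σ_{E′})`. [cite: GreenbergVatsal2000, Thm. (1.4), (1.5)] [cite: Hsieh2014, Thm. B] -/
theorem defectTransportModThreePT_of_deepNormDominance
    (hB : Literature.NumberTheory.EllipticCurves.Hsieh2014.thmB_exists_isHsiehLFunction_coeff_norm_eq_one_unrPeriod_anyLevel)
    (h : DeepNormDominanceAtThree) : DefectTransportModThreePT := by
  haveI : Fact (Nat.Prime 3) := ⟨Nat.prime_three⟩
  unfold DeepNormDominanceAtThree DeepNormShapeAtThree at h
  refine defectTransportModThreePT_of_thmB_of_lambdaLe hB ?_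
  intro W _ _ W' _ _ N N' _ _ K _ _ Dt Dt' hO6 hsurj hrk hN hmod haddv hN' hK hH hH' κ hκ γ _ 𝔭 h𝔭 hram hdeg 𝔭'
    h𝔭' hne ι' hι ΩK Ωp L hΩK hΩp hL ΩK' Ωp' L' hΩK' hΩp' hL' hi' T c hT hc m m' hm hm'
  have hT3 := not_mem_of_coe_eq hT
  exact profile_le_of_forall_layer (normProfile_sigma (W.baseChange K) T hT3 c hm)
    (normProfile_sigma (W'.baseChange K) T hT3 c hm')
    (h W W' N N' K Dt Dt' hO6 hsurj hrk hN hmod haddv hN' hK hH hH' κ hκ γ 𝔭 h𝔭 hram hdeg 𝔭' h𝔭' hne ι' hι ΩK Ωp L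
      hΩK hΩp hL ΩK' Ωp' L' hΩK' hΩp' hL' hi' T c hT hc)

/-- **C≤ ⟹ … and C⁼ ⟹ the PARENT** (composition of the two previous). [folklore] -/
theorem defectTransportModThreePT_of_deepNormTransfer
    (hB : Literature.NumberTheory.EllipticCurves.Hsieh2014.thmB_exists_isHsiehLFunction_coeff_norm_eq_one_unrPeriod_anyLevel)
    (h : DeepNormTransferAtThree) : DefectTransportModThreePT :=
  defectTransportModThreePT_of_deepNormDominance hB (deepNormDominance_of_deepNormTransfer h)

/-- **A ⟹ C⁼ (certifies the EQUIV tag, modulo `hB`).** From A the λ-identity; the profiles of `𝓛` (print, `hB`) and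
`𝓛′` (hypothesis `μ(𝓛′) = 0`) give equal profiles of the Σ-depletions, and `norm_value_eq_of_profile_eq` is the law at
every layer under the guard. [cite: GreenbergVatsal2000, Thm. (1.5)] [cite: Hsieh2014, Thm. B] -/
theorem deepNormTransfer_of_sigmaCongruenceAtThree
    (hB : Literature.NumberTheory.EllipticCurves.Hsieh2014.thmB_exists_isHsiehLFunction_coeff_norm_eq_one_unrPeriod_anyLevel)
    (hA : SigmaCongruenceAtThree) : DeepNormTransferAtThree := by
  haveI : Fact (Nat.Prime 3) := ⟨Nat.prime_three⟩
  have hΛ := (sigmaCongruenceAtThree_iff_lambdaIdentity_of_thmB hB).mp hA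
  unfold DeepNormTransferAtThree DeepNormShapeAtThree
  intro W _ _ W' _ _ N N' _ _ K _ _ Dt Dt' hO6 hsurj hrk hN hmod haddv hN' hK hH hH' κ hκ γ _ 𝔭 h𝔭 hram hdeg 𝔭'
    h𝔭' hne ι' hι ΩK Ωp L hΩK hΩp hL ΩK' Ωp' L' hΩK' hΩp' hL' hi' T c hT hc n hn ζ hζ vX vY hvX hvY hguard
  have hT3 := not_mem_of_coe_eq hT
  obtain ⟨m, hm⟩ := UniversalToricDescentSelfMuZero.exists_normProfile_of_exists_coeff_norm_eq_one
    (UniversalToricDescentSelfMuZero.self_forall_isBDPLFunction_coeff_norm_eq_one hB W N K Dt hO6 hsurj hrk hN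
      hK hH κ hκ γ 𝔭 h𝔭 hram hdeg 𝔭' h𝔭' hne ι' hι ΩK Ωp L hΩK hΩp hL)
  obtain ⟨m', hm'⟩ := UniversalToricDescentSelfMuZero.exists_normProfile_of_exists_coeff_norm_eq_one hi'
  have hXp := normProfile_sigma (W.baseChange K) T hT3 c hm
  have hYp := normProfile_sigma (W'.baseChange K) T hT3 c hm'
  have heq := hΛ W W' N N' K Dt Dt' hO6 hsurj hrk hN hmod haddv hN' hK hH hH' κ hκ γ 𝔭 h𝔭 hram hdeg 𝔭' h𝔭' hne ι'
    hι ΩK Ωp L hΩK hΩp hL ΩK' Ωp' L' hΩK' hΩp' hL' hi' T c hT hc m m' hm hm'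
  rw [heq] at hXp
  rw [norm_three] at hguard
  exact norm_value_eq_of_profile_eq hXp hYp hn hζ hvX hvY hguard


/-! ## §5 HL3 — SCALE FORCING (PROVED): a constant norm RATIO across the deep layers already decides `λ(X) = λ(Y)`

The guard-free companion of §1–§4.  If the deep values of `X` and `Y` have norms in a FIXED ratio `ρ` at all layers
`n ≥ N₀` — which is what the Heegner currency delivers (HL1_E ∧ HL1_E′ ∧ HL2 at all large layers give
`‖X(ζₙ−1)‖ = ‖c_E/c_E′‖²·‖Y(ζₙ−1)‖`, the Gauss factor `κ(χ)` and the local factor at the split prime `3` being the SAME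
for `E` and `E′`) — then reading TWO consecutive layers past `max(λ(X), λ(Y))` gives `ρ = ‖ζₙ−1‖^{λ(X)−λ(Y)} =
‖ζₙ₊₁−1‖^{λ(X)−λ(Y)}` with `‖ζₙ−1‖^{φ(3ⁿ)} = ‖ζₙ₊₁−1‖^{3φ(3ⁿ)} = 1/3`, impossible unless `λ(X) = λ(Y)` (and then
`ρ = 1`).  So the unknown wild period constant is never evaluated and never assumed to be a unit: it is READ.
This answers the route's why-might-fail clause «the period normalisation need not be 𝔪-integral» for this line. -/

/-- `φ(3ⁿ⁺¹) = 3·φ(3ⁿ)` for `n ≥ 1`. [folklore] -/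
theorem totient_three_pow_succ {n : ℕ} (hn : 0 < n) :
    Nat.totient (3 ^ (n + 1)) = 3 * Nat.totient (3 ^ n) := by
  obtain ⟨k, rfl⟩ : ∃ k, n = k + 1 := ⟨n - 1, by omega⟩
  rw [Nat.totient_prime_pow_succ Nat.prime_three, Nat.totient_prime_pow_succ Nat.prime_three, pow_succ]
  ring

/-- Two radii `a, b` with `a^φ = 1/3 = b^{3φ}` cannot have a common positive power. [folklore] -/
private theorem no_two_layers {a b : ℝ} {φ d : ℕ} (ha0 : 0 ≤ a) (hb0 : 0 ≤ b) (hd : d ≠ 0)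
    (haφ : a ^ φ = ((3 : ℕ) : ℝ)⁻¹) (hbφ : b ^ (3 * φ) = ((3 : ℕ) : ℝ)⁻¹) (h : a ^ d = b ^ d) : False := by
  have hab : a = b := (pow_left_inj₀ ha0 hb0 hd).mp h
  subst hab
  rw [mul_comm, pow_mul, haφ] at hbφ
  norm_num at hbφ

/-- **HL3 decider (PROVED).** If `‖X(ζ−1)‖ = ρ·‖Y(ζ−1)‖` with ONE real `ρ` at every layer `n ≥ N₀` (all primitive
`3ⁿ`-th roots `ζ`, all values), then `λ(X) = λ(Y)`. [folklore] -/
theorem profile_eq_of_forall_layer_ratio {X Y : UnrSeries 3} {M M' : ℕ}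
    (hX : (∀ i < M, ‖((PowerSeries.coeff i X : unrIntegers 3) : ℂ_[3])‖ < 1) ∧
      ‖((PowerSeries.coeff M X : unrIntegers 3) : ℂ_[3])‖ = 1)
    (hY : (∀ i < M', ‖((PowerSeries.coeff i Y : unrIntegers 3) : ℂ_[3])‖ < 1) ∧
      ‖((PowerSeries.coeff M' Y : unrIntegers 3) : ℂ_[3])‖ = 1)
    {ρ : ℝ} {N₀ : ℕ}
    (h : ∀ n : ℕ, N₀ ≤ n → 0 < n → ∀ ζ : ℂ_[3], IsPrimitiveRoot ζ (3 ^ n) → ∀ vX vY : ℂ_[3],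
      X.HasValueAt (ζ - 1) vX → Y.HasValueAt (ζ - 1) vY → ‖vX‖ = ρ * ‖vY‖) : M = M' := by
  by_contra hne
  set n : ℕ := N₀ + M + M' + 1 with hn
  have hn1 : 0 < n := by omega
  have hn2 : 0 < n + 1 := by omega
  have hφ : Nat.totient (3 ^ n) = 2 * 3 ^ (n - 1) := by
    rw [Nat.totient_prime_pow Nat.prime_three hn1]; ring
  have h3pow : n - 1 < 3 ^ (n - 1) := Nat.lt_pow_self (by norm_num)
  have hMφ : M < Nat.totient (3 ^ n) := by rw [hφ]; omega
  have hM'φ : M' < Nat.totient (3 ^ n) := by rw [hφ]; omega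
  have hφ' : Nat.totient (3 ^ (n + 1)) = 3 * Nat.totient (3 ^ n) := totient_three_pow_succ hn1
  have hMφ' : M < Nat.totient (3 ^ (n + 1)) := by rw [hφ']; omega
  have hM'φ' : M' < Nat.totient (3 ^ (n + 1)) := by rw [hφ']; omega
  haveI : NeZero ((3 : ℕ) : ℂ_[3]) := ⟨by exact_mod_cast (show (3 : ℕ) ≠ 0 by norm_num)⟩
  obtain ⟨ζ, hζ⟩ := HasEnoughRootsOfUnity.prim (M := ℂ_[3]) (n := 3 ^ n)
  obtain ⟨ξ, hξ⟩ := HasEnoughRootsOfUnity.prim (M := ℂ_[3]) (n := 3 ^ (n + 1))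
  obtain ⟨hr0, hr1⟩ := norm_sub_one_pos_lt_one_of_isPrimitiveRoot_prime_pow hn1 hζ
  obtain ⟨hs0, hs1⟩ := norm_sub_one_pos_lt_one_of_isPrimitiveRoot_prime_pow hn2 hξ
  have hrφ : ‖ζ - 1‖ ^ Nat.totient (3 ^ n) = ((3 : ℕ) : ℝ)⁻¹ :=
    norm_sub_one_pow_totient_of_isPrimitiveRoot_prime_pow hn1 hζ
  have hsφ : ‖ξ - 1‖ ^ Nat.totient (3 ^ (n + 1)) = ((3 : ℕ) : ℝ)⁻¹ :=
    norm_sub_one_pow_totient_of_isPrimitiveRoot_prime_pow hn2 hξ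
  rw [hφ'] at hsφ
  obtain ⟨vX, hvX⟩ := exists_hasValueAt X hr1
  obtain ⟨vY, hvY⟩ := exists_hasValueAt Y hr1
  obtain ⟨wX, hwX⟩ := exists_hasValueAt X hs1
  obtain ⟨wY, hwY⟩ := exists_hasValueAt Y hs1
  have h1 := h n (by omega) hn1 ζ hζ vX vY hvX hvY
  have h2 := h (n + 1) (by omega) hn2 ξ hξ wX wY hwX hwY
  rw [(norm_value_eq_of_profile hn1 hX hMφ hζ hvX).1, (norm_value_eq_of_profile hn1 hY hM'φ hζ hvY).1] at h1
  rw [(norm_value_eq_of_profile hn2 hX hMφ' hξ hwX).1, (norm_value_eq_of_profile hn2 hY hM'φ' hξ hwY).1] at h2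
  rcases Nat.lt_or_gt_of_ne hne with hlt | hgt
  · -- `M < M'`: `1 = ρ·r^d` at both layers
    obtain ⟨d, rfl⟩ : ∃ d, M' = M + d := ⟨M' - M, by omega⟩
    have hd : d ≠ 0 := by omega
    rw [pow_add] at h1 h2
    have k1 : ‖ζ - 1‖ ^ M * 1 = ‖ζ - 1‖ ^ M * (ρ * ‖ζ - 1‖ ^ d) := by linear_combination h1
    have k2 : ‖ξ - 1‖ ^ M * 1 = ‖ξ - 1‖ ^ M * (ρ * ‖ξ - 1‖ ^ d) := by linear_combination h2
    have e1 := mul_left_cancel₀ (pow_pos hr0 M).ne' k1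
    have e2 := mul_left_cancel₀ (pow_pos hs0 M).ne' k2
    have hρ : ρ ≠ 0 := by rintro rfl; simp at e1
    have e : ‖ζ - 1‖ ^ d = ‖ξ - 1‖ ^ d := mul_left_cancel₀ hρ (e1.symm.trans e2)
    exact no_two_layers hr0.le hs0.le hd hrφ hsφ e
  · -- `M' < M`: `r^d = ρ` at both layers
    obtain ⟨d, rfl⟩ : ∃ d, M = M' + d := ⟨M - M', by omega⟩
    have hd : d ≠ 0 := by omega
    rw [pow_add] at h1 h2
    have k1 : ‖ζ - 1‖ ^ M' * ‖ζ - 1‖ ^ d = ‖ζ - 1‖ ^ M' * ρ := by linear_combination h1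
    have k2 : ‖ξ - 1‖ ^ M' * ‖ξ - 1‖ ^ d = ‖ξ - 1‖ ^ M' * ρ := by linear_combination h2
    have e1 := mul_left_cancel₀ (pow_pos hr0 M').ne' k1
    have e2 := mul_left_cancel₀ (pow_pos hs0 M').ne' k2
    exact no_two_layers hr0.le hs0.le hd hrφ hsφ (e1.trans e2.symm)

/-- Equal profiles give the ratio law with `ρ = 1` from the layer `λ + 1` on. [folklore] -/
theorem ratio_one_of_profile_eq {X Y : UnrSeries 3} {M : ℕ}
    (hX : (∀ i < M, ‖((PowerSeries.coeff i X : unrIntegers 3) : ℂ_[3])‖ < 1) ∧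
      ‖((PowerSeries.coeff M X : unrIntegers 3) : ℂ_[3])‖ = 1)
    (hY : (∀ i < M, ‖((PowerSeries.coeff i Y : unrIntegers 3) : ℂ_[3])‖ < 1) ∧
      ‖((PowerSeries.coeff M Y : unrIntegers 3) : ℂ_[3])‖ = 1) :
    ∃ ρ : ℝ, ∃ N₀ : ℕ, ∀ n : ℕ, N₀ ≤ n → 0 < n → ∀ ζ : ℂ_[3], IsPrimitiveRoot ζ (3 ^ n) → ∀ vX vY : ℂ_[3],
      X.HasValueAt (ζ - 1) vX → Y.HasValueAt (ζ - 1) vY → ‖vX‖ = ρ * ‖vY‖ := by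
  refine ⟨1, M + 1, fun n hn0 hn ζ hζ vX vY hvX hvY ↦ ?_⟩
  have hφ : Nat.totient (3 ^ n) = 2 * 3 ^ (n - 1) := by
    rw [Nat.totient_prime_pow Nat.prime_three hn]; ring
  have h3pow : n - 1 < 3 ^ (n - 1) := Nat.lt_pow_self (by norm_num)
  have hMφ : M < Nat.totient (3 ^ n) := by rw [hφ]; omega
  rw [(norm_value_eq_of_profile hn hX hMφ hζ hvX).1, (norm_value_eq_of_profile hn hY hMφ hζ hvY).1, one_mul]

/-- **C^ρ `DeepNormRatioAtThree` (tag EQUIV to A modulo `hB`; UNDECIDED; GUARD-FREE).** «On A's binders, the deep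
values of the two Σ-depleted frames have norms in ONE fixed real ratio `ρ` at every layer past some `N₀`.»  This is
the form the Heegner currency produces directly: HL1_E ∧ HL1_E′ (p-adic Waldspurger shapes with χ-free constants
`c_E, c_E′` and the COMMON local factor `κ(χ)` at the split prime) ∧ HL2 (equal norms of the Gauss-normalised
Σ-depleted Heegner-log sums at all large layers, the t-expansion form of Kriz–Li) give it with `ρ = ‖c_E/c_E′‖²` —
no unit hypothesis on any period.  [cite: KrizLi2019, Thm. 3.9, Rem. 3.10] [cite: LiuZhangZhang2018, Thm. 1.1.1]
[cite: CastellaHsieh2018, Thm. 4.9] -/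
def DeepNormRatioAtThree : Prop :=
      ∀ (W : WeierstrassCurve ℚ) [W.IsElliptic] [W.IsGloballyMinimal] (W' : WeierstrassCurve ℚ) [W'.IsElliptic]
      [W'.IsGloballyMinimal] (N N' : ℕ) [NeZero N] [NeZero N'] (K : Type) [Field K] [NumberField K] (Dt :
      Literature.NumberTheory.EllipticCurves.ModularForms.ModularParametrizationData W N) (Dt' :
      Literature.NumberTheory.EllipticCurves.ModularForms.ModularParametrizationData W' N'),
      Summit.BirchSwinnertonDyer.Rank1Residual.Additive.ClassO6 W 3 → W.HasSurjectiveModNGaloisRep 3 →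
      W.analyticRank = 1 → W.conductorNorm ℤ = N → Summit.BirchSwinnertonDyer.Rank1Residual.O6.ModPCongruent W' W
      3 → ¬ Literature.NumberTheory.EllipticCurves.Rank1Residual.Addv W' 3 → W'.conductorNorm ℤ = N' →
      Literature.NumberTheory.EllipticCurves.IsImaginaryQuadratic K →
      Literature.NumberTheory.EllipticCurves.SatisfiesHeegnerHypothesis N K →
      Literature.NumberTheory.EllipticCurves.SatisfiesHeegnerHypothesis N' K → ∀ (κ :
      Literature.NumberTheory.EllipticCurves.ZpExtension K 3), κ.IsAnticyclotomic → ∀ (γ :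
      Field.absoluteGaloisGroup K) [Fact (κ.IsTopGenerator γ)] (𝔭 : IsDedekindDomain.HeightOneSpectrum
      (NumberField.RingOfIntegers K)), ((3 : ℕ) : NumberField.RingOfIntegers K) ∈ 𝔭.asIdeal →
      𝔭.asIdeal.ramificationIdx (NumberField.RingOfIntegers ℚ) = 1 → 𝔭.asIdeal.inertiaDeg
      (NumberField.RingOfIntegers ℚ) = 1 → ∀ (𝔭' : IsDedekindDomain.HeightOneSpectrum (NumberField.RingOfIntegers
      K)), ((3 : ℕ) : NumberField.RingOfIntegers K) ∈ 𝔭'.asIdeal → 𝔭' ≠ 𝔭 → ∀ (ι' : PadicAlgCl 3 ≃+* ℂ),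
      Summit.BirchSwinnertonDyer.BirchSwinnertonDyer.Theorems.SchneiderFree.BranchInducesPrime 3 ι' 𝔭 → ∀ (ΩK : ℂ)
      (Ωp : ℂ_[3]) (L : Literature.NumberTheory.EllipticCurves.UnrSeries 3), ΩK ≠ 0 → Ωp ≠ 0 →
      Literature.NumberTheory.EllipticCurves.IsBDPLFunction ι' 𝔭 κ γ Dt.f ΩK Ωp L → ∀ (ΩK' : ℂ) (Ωp' : ℂ_[3]) (L'
      : Literature.NumberTheory.EllipticCurves.UnrSeries 3), ΩK' ≠ 0 → Ωp' ≠ 0 →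
      Literature.NumberTheory.EllipticCurves.IsBDPLFunction ι' 𝔭 κ γ Dt'.f ΩK' Ωp' L' → (∃ i : ℕ,
      ‖((PowerSeries.coeff i L' : Literature.NumberTheory.EllipticCurves.unrIntegers 3) : ℂ_[3])‖ = 1) → ∀ (T :
      Finset (IsDedekindDomain.HeightOneSpectrum (NumberField.RingOfIntegers K))) (c :
      IsDedekindDomain.HeightOneSpectrum (NumberField.RingOfIntegers K) → ℕ), (↑T = {v :
      IsDedekindDomain.HeightOneSpectrum (NumberField.RingOfIntegers K) | ((3 : ℕ) : NumberField.RingOfIntegers K)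
      ∉ v.asIdeal ∧ (¬ (W.baseChange K).HasGoodReductionAt v ∨ ¬ (W'.baseChange K).HasGoodReductionAt v)}) → (∀ v
      ∈ T, (∃ d₀ : Literature.NumberTheory.EllipticCurves.GreenbergSelmer.decomp (K := K) v, (κ (d₀ :
      Field.absoluteGaloisGroup K)).toAdd = (3 : ℤ_[3]) ^ c v) ∧ (∀ d :
      Literature.NumberTheory.EllipticCurves.GreenbergSelmer.decomp (K := K) v, (3 : ℤ_[3]) ^ c v ∣ (κ (d :
      Field.absoluteGaloisGroup K)).toAdd)) →
      ∃ ρ : ℝ, ∃ N₀ : ℕ, ∀ n : ℕ, N₀ ≤ n → 0 < n → ∀ ζ : ℂ_[3], IsPrimitiveRoot ζ (3 ^ n) → ∀ vX vY : ℂ_[3],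
        UnrSeries.HasValueAt (L * PowerSeries.map (Halves.toUnr 3) (∏ v ∈ T, (Polynomial.aeval
          (PowerSeries.C ((Nat.card (IsLocalRing.ResidueField (v.adicCompletionIntegers K)) : ℤ_[3]).inv) *
            PowerSeries.binomialSeries ℤ_[3] ((3 : ℤ_[3]) ^ c v)) ((W.baseChange K).localPolynomialAt v) :
            IwasawaAlgebra 3))) (ζ - 1) vX →
        UnrSeries.HasValueAt (L' * PowerSeries.map (Halves.toUnr 3) (∏ v ∈ T, (Polynomial.aeval
          (PowerSeries.C ((Nat.card (IsLocalRing.ResidueField (v.adicCompletionIntegers K)) : ℤ_[3]).inv) *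
            PowerSeries.binomialSeries ℤ_[3] ((3 : ℤ_[3]) ^ c v)) ((W'.baseChange K).localPolynomialAt v) :
            IwasawaAlgebra 3))) (ζ - 1) vY →
        ‖vX‖ = ρ * ‖vY‖

/-- **C^ρ ⟹ A `SigmaCongruenceAtThree` BY NAME** (modulo `hB`), by the HL3 decider. [cite: GreenbergVatsal2000, Thm. (1.5)]
[cite: Hsieh2014, Thm. B] -/
theorem sigmaCongruenceAtThree_of_deepNormRatio
    (hB : Literature.NumberTheory.EllipticCurves.Hsieh2014.thmB_exists_isHsiehLFunction_coeff_norm_eq_one_unrPeriod_anyLevel)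
    (h : DeepNormRatioAtThree) : SigmaCongruenceAtThree := by
  haveI : Fact (Nat.Prime 3) := ⟨Nat.prime_three⟩
  unfold DeepNormRatioAtThree at h
  refine (sigmaCongruenceAtThree_iff_lambdaIdentity_of_thmB hB).mpr ?_
  intro W _ _ W' _ _ N N' _ _ K _ _ Dt Dt' hO6 hsurj hrk hN hmod haddv hN' hK hH hH' κ hκ γ _ 𝔭 h𝔭 hram hdeg 𝔭'
    h𝔭' hne ι' hι ΩK Ωp L hΩK hΩp hL ΩK' Ωp' L' hΩK' hΩp' hL' hi' T c hT hc m m' hm hm'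
  have hT3 := not_mem_of_coe_eq hT
  obtain ⟨ρ, N₀, hρ⟩ := h W W' N N' K Dt Dt' hO6 hsurj hrk hN hmod haddv hN' hK hH hH' κ hκ γ 𝔭 h𝔭 hram hdeg 𝔭'
    h𝔭' hne ι' hι ΩK Ωp L hΩK hΩp hL ΩK' Ωp' L' hΩK' hΩp' hL' hi' T c hT hc
  exact profile_eq_of_forall_layer_ratio (normProfile_sigma (W.baseChange K) T hT3 c hm)
    (normProfile_sigma (W'.baseChange K) T hT3 c hm') hρ

/-- **C^ρ ⟹ the PARENT `DefectTransportModThreePT` BY NAME** (modulo `hB`). -/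
theorem defectTransportModThreePT_of_deepNormRatio
    (hB : Literature.NumberTheory.EllipticCurves.Hsieh2014.thmB_exists_isHsiehLFunction_coeff_norm_eq_one_unrPeriod_anyLevel)
    (h : DeepNormRatioAtThree) : DefectTransportModThreePT :=
  defectTransportModThreePT_of_deepNormTransfer hB
    (deepNormTransfer_of_sigmaCongruenceAtThree hB (sigmaCongruenceAtThree_of_deepNormRatio hB h))

/-- **A ⟹ C^ρ with `ρ = 1`, `N₀ = λ(Y) + 1` (certifies the EQUIV tag of C^ρ, modulo `hB`).** -/
theorem deepNormRatio_of_sigmaCongruenceAtThree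
    (hB : Literature.NumberTheory.EllipticCurves.Hsieh2014.thmB_exists_isHsiehLFunction_coeff_norm_eq_one_unrPeriod_anyLevel)
    (hA : SigmaCongruenceAtThree) : DeepNormRatioAtThree := by
  haveI : Fact (Nat.Prime 3) := ⟨Nat.prime_three⟩
  have hΛ := (sigmaCongruenceAtThree_iff_lambdaIdentity_of_thmB hB).mp hA
  unfold DeepNormRatioAtThree
  intro W _ _ W' _ _ N N' _ _ K _ _ Dt Dt' hO6 hsurj hrk hN hmod haddv hN' hK hH hH' κ hκ γ _ 𝔭 h𝔭 hram hdeg 𝔭'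
    h𝔭' hne ι' hι ΩK Ωp L hΩK hΩp hL ΩK' Ωp' L' hΩK' hΩp' hL' hi' T c hT hc
  have hT3 := not_mem_of_coe_eq hT
  obtain ⟨m, hm⟩ := UniversalToricDescentSelfMuZero.exists_normProfile_of_exists_coeff_norm_eq_one
    (UniversalToricDescentSelfMuZero.self_forall_isBDPLFunction_coeff_norm_eq_one hB W N K Dt hO6 hsurj hrk hN
      hK hH κ hκ γ 𝔭 h𝔭 hram hdeg 𝔭' h𝔭' hne ι' hι ΩK Ωp L hΩK hΩp hL)
  obtain ⟨m', hm'⟩ := UniversalToricDescentSelfMuZero.exists_normProfile_of_exists_coeff_norm_eq_one hi'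
  have hXp := normProfile_sigma (W.baseChange K) T hT3 c hm
  have hYp := normProfile_sigma (W'.baseChange K) T hT3 c hm'
  have heq := hΛ W W' N N' K Dt Dt' hO6 hsurj hrk hN hmod haddv hN' hK hH hH' κ hκ γ 𝔭 h𝔭 hram hdeg 𝔭' h𝔭' hne ι'
    hι ΩK Ωp L hΩK hΩp hL ΩK' Ωp' L' hΩK' hΩp' hL' hi' T c hT hc m m' hm hm'
  rw [heq] at hXp
  exact ratio_one_of_profile_eq hXp hYp

end Summit.BirchSwinnertonDyer.BirchSwinnertonDyer.Cruxes.SigmaCongruenceAtThree.OneDeepLayer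

end
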